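import Summits.QuantumFields.YangMills.Theorems.LuscherReductionTwistedTraceScalingStubFixedLatticeTraceLaw
import Summits.QuantumFields.YangMills.Theorems.TwistedTraceScaling.Negative.CmpTwoLoopIffUniformOfBase
import Summits.QuantumFields.YangMills.Theorems.LuscherReductionTwistedTraceScalingTowerE1
import HarnessLib

/-!
# ★★★★★ THE CRUX `TwistedTraceScaling` (stmt-QuantumFields-20203) MODULO ITS ONE REMAINING REGISTERED STUB CMP-2LOOP — S-BASE and TRACK discharged from the tree;
# and, unconditionally now, CMP-2LOOP ⟺ the uniform femto trace law ⟺ rev 2's TOWER-E1 ⟺ rev 1's S-TOWER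
# (route `LuscherReduction`, line «twolattice» skeleton rev 3; fleet base ym-luscher-20007-p1, lead g24)

With the registered stub S-BASE landed BY NAME (✓`TwoLattice.stub_fixedLatticeTraceLaw`, this lineage) and TRACK landed (✓`TwoLattice.stub_labelTracking`, p548356), the skeleton's composition
`TwistedTraceScaling_of hC hT hBASE` becomes a one-hypothesis theorem of the tree, and the disprover's «modulo S-BASE» dictionary (✓`…Negative.R3.*`, `…CmpTwoLoopIffUniformOfBase`) loses
its S-BASE hypothesis:
* ★★★★★ `twistedTraceScaling_of_cmpTwoLoop : Stmt.stub_cmpTwoLoop → Theses.LuscherReduction.TwistedTraceScaling` — the CRUX BY NAME from CMP-2LOOP ALONE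
  (✓`Tower.twistedTraceScaling_of_towerE1_of_base` ∘ ✓`R3.towerE1_of_cmpTwoLoop`, S-BASE := ✓`stub_fixedLatticeTraceLaw`);
* `uniform_of_cmpTwoLoop` (CMP-2LOOP ⇒ UFTL; the crux from UFTL alone is already the tree's ✓`Tower.twistedTraceScaling_of_uniform`, `…OfFemtoTraceLaw`);
* ★★★ `cmpTwoLoop_iff_uniform`, `cmpTwoLoop_iff_towerE1`, `cmpTwoLoop_iff_twoLatticeUniversality`, `cmpTwoLoop_of_cmpSome` — unconditional forms of ✓`R3.…_of_base`.
So the open content of the crux is EXACTLY ONE text in four equivalent currencies: the `L`-UNIFORM femto trace law (Lüscher's zero-mode asymptotics uniformly on the approach to the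
small-volume continuum limit — the RG statement; XL, not in print: W-REP + W-CMP + the two-loop law for Bałaban's true flow).
HONEST FRAMING: compositions only; CMP-2LOOP ≡ UFTL is OPEN; the crux `TwistedTraceScaling` is NOT closed; the route R2b1 (Lüscher two-lattice reduction) is CONDITIONAL; the fixed-lattice
theorems behind S-BASE hold eventually in `β` with `L`-dependent thresholds and say nothing uniform in `L`; not infinite volume, not a mass gap, not Clay.  No definitions, no `sorry`.
-/

set_option autoImplicit false

noncomputable section

open MeasureTheory Filter Topology Real
open Literature.MathematicalPhysics.QuantumFieldTheory hiding SU2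
open Literature.MathematicalPhysics.QuantumFieldTheory.Balaban1983to89
open scoped BigOperators

namespace Summit.QuantumFields.YangMills.Theorems.FemtoTransferGap.TwoLattice

open Summit.QuantumFields.YangMills.Theorems.FemtoTransferGap
open Summit.QuantumFields.YangMills.Theorems.FemtoTransferGap.TraceDoor
open Summit.QuantumFields.YangMills.Theorems.TwistedTraceScaling.Negative

/-- ★★★★★ **THE CRUX `TwistedTraceScaling` FROM CMP-2LOOP ALONE** — the registered skeleton's composition `TwistedTraceScaling_of hC hT hBASE` with TRACK (✓`stub_labelTracking`) and
S-BASE (✓`stub_fixedLatticeTraceLaw`) discharged from the tree: CMP-2LOOP ⇒ TOWER-E1 (✓`R3.towerE1_of_cmpTwoLoop`) ⇒ the crux by ✓`Tower.twistedTraceScaling_of_towerE1_of_base`.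
[cite: Luscher1983, §3] [cite: Balaban1989LargeFieldII, pp. 355–6] [cite: LuscherWeiszWolff1991, §2] -/
theorem twistedTraceScaling_of_cmpTwoLoop (hC : Stmt.stub_cmpTwoLoop) :
    Summit.QuantumFields.YangMills.Theses.LuscherReduction.TwistedTraceScaling :=
  Tower.twistedTraceScaling_of_towerE1_of_base (R3.towerE1_of_cmpTwoLoop hC) stub_fixedLatticeTraceLaw

/-- ★★★ **CMP-2LOOP ⇒ UFTL**, unconditionally (✓`R3.uniform_of_cmpTwoLoop_of_base` at ✓`stub_fixedLatticeTraceLaw`). [cite: Luscher1983, §3] -/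
theorem uniform_of_cmpTwoLoop (hC : Stmt.stub_cmpTwoLoop) :
    ∀ s : ℝ, 0 < s → ∀ ε : ℝ, 0 < ε → ∃ L0 : ℕ, ∃ lam0 : ℝ, 0 < lam0 ∧ ∀ lam : ℝ, 0 < lam → lam ≤ lam0 →
      ∀ (L : ℕ) [NeZero L], L0 ≤ L → ∀ β : ℝ, InFemtoWindow lam β L →
        |traceRatio L β (femtoSteps s β L) - hTraceRatio s| ≤ ε :=
  R3.uniform_of_cmpTwoLoop_of_base hC stub_fixedLatticeTraceLaw

/-- ★★★ **CMP-2LOOP ⟺ UFTL**, unconditionally: the one remaining registered stub of line «twolattice» IS the `lam`-uniform femto trace law (✓`R3.cmpTwoLoop_iff_uniform_of_base` at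
✓`stub_fixedLatticeTraceLaw`). [cite: Luscher1983, §3] -/
theorem cmpTwoLoop_iff_uniform :
    Stmt.stub_cmpTwoLoop ↔
    (∀ s : ℝ, 0 < s → ∀ ε : ℝ, 0 < ε → ∃ L0 : ℕ, ∃ lam0 : ℝ, 0 < lam0 ∧ ∀ lam : ℝ, 0 < lam → lam ≤ lam0 →
      ∀ (L : ℕ) [NeZero L], L0 ≤ L → ∀ β : ℝ, InFemtoWindow lam β L →
        |traceRatio L β (femtoSteps s β L) - hTraceRatio s| ≤ ε) :=
  R3.cmpTwoLoop_iff_uniform_of_base stub_fixedLatticeTraceLaw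

/-- ★★★ **CMP-2LOOP ⟺ rev 2's TOWER-E1**, unconditionally (✓`R3.cmpTwoLoop_iff_towerE1_of_base` at ✓`stub_fixedLatticeTraceLaw`). [folklore] -/
theorem cmpTwoLoop_iff_towerE1 :
    Stmt.stub_cmpTwoLoop ↔
    (∀ s : ℝ, 0 < s → ∀ ε : ℝ, 0 < ε → ∃ M : ℕ, 2 ≤ M ∧ ∃ lam0 : ℝ, 0 < lam0 ∧ ∀ lam : ℝ, 0 < lam → lam ≤ lam0 →
      ∀ (L : ℕ) [NeZero L], M ^ 2 ≤ L → ∀ β : ℝ, InFemtoWindow lam β L →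
        ∀ (b k : ℕ) [NeZero b], M ≤ b → b < M ^ 2 → b * M ^ (k + 1) ≤ L → L < b * M ^ k * (M + 1) →
          ∀ β₁ : ℝ, 1 ≤ β₁ → invRunningCoupling β₁ b = invRunningCoupling β L →
            |traceRatio L β (femtoSteps s β L) - traceRatio b β₁ (femtoSteps s β₁ b)| ≤ ε) :=
  R3.cmpTwoLoop_iff_towerE1_of_base stub_fixedLatticeTraceLaw

/-- ★★★ **CMP-2LOOP ⟺ rev 1's all-pairs S-TOWER**, unconditionally (✓`R3.cmpTwoLoop_iff_twoLatticeUniversality_of_base` at ✓`stub_fixedLatticeTraceLaw`). [folklore] -/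
theorem cmpTwoLoop_iff_twoLatticeUniversality :
    Stmt.stub_cmpTwoLoop ↔
    (∀ s : ℝ, 0 < s → ∀ ε : ℝ, 0 < ε → ∃ L0 : ℕ, ∃ lam0 : ℝ, 0 < lam0 ∧ ∀ lam : ℝ, 0 < lam → lam ≤ lam0 →
      ∀ (L1 : ℕ) [NeZero L1], L0 ≤ L1 → ∀ (L : ℕ) [NeZero L], L1 ≤ L → ∀ β : ℝ, InFemtoWindow lam β L →
        ∀ β₁ : ℝ, 1 ≤ β₁ → invRunningCoupling β₁ L1 = invRunningCoupling β L →
          |traceRatio L β (femtoSteps s β L) - traceRatio L1 β₁ (femtoSteps s β₁ L1)| ≤ ε) :=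
  R3.cmpTwoLoop_iff_twoLatticeUniversality_of_base stub_fixedLatticeTraceLaw

/-- ★★★ **One lawful calibrator suffices**, unconditionally: CMP-2LOOP asserted for SOME two-loop calibrator at the chosen `M` implies the registered text for EVERY one
(✓`R3.cmpTwoLoop_of_cmpSome_of_base` at ✓`stub_fixedLatticeTraceLaw`). [folklore] -/
theorem cmpTwoLoop_of_cmpSome
    (hSome : ∀ s : ℝ, 0 < s → ∀ ε : ℝ, 0 < ε → ∃ M : ℕ, 2 ≤ M ∧ ∃ δ : ℝ, 0 < δ ∧
      ∃ φ : FlowStep.HBeta, Stmt.twoLoopLawH (B12Normalization.stepBal 2 M) (twoLoopStepBal M) φ ∧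
        ∃ lam0 : ℝ, 0 < lam0 ∧ ∀ lam : ℝ, 0 < lam → lam ≤ lam0 →
          ∀ (L : ℕ) [NeZero L], M ^ 2 ≤ L → ∀ β : ℝ, InFemtoWindow lam β L →
            ∀ (b k : ℕ) [NeZero b], M ≤ b → b < M ^ 2 → b * M ^ (k + 1) ≤ L → L < b * M ^ k * (M + 1) →
              1 / (4 * lam ^ 3) ≤ flowInvSq φ β (k + 1) →
              ∀ β₁ : ℝ, 1 ≤ β₁ → |flowInvSq φ β (k + 1) - 2 * β₁| ≤ δ * (2 * β₁) →
                ∀ T : ℕ, |(T : ℝ) * calLambda φ β (k + 1) b / L - s| ≤ δ →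
                  |traceRatio L β T - traceRatio b β₁ (femtoSteps s β₁ b)| ≤ ε) :
    Stmt.stub_cmpTwoLoop :=
  R3.cmpTwoLoop_of_cmpSome_of_base hSome stub_fixedLatticeTraceLaw

end Summit.QuantumFields.YangMills.Theorems.FemtoTransferGap.TwoLattice

end
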